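import Mathlib
import Summits.Ventures.HodgeRepro2.T5DVRQuotientModel
import Summits.Ventures.HodgeRepro2.T5PrincipalUnitFiltration
import Summits.Ventures.HodgeRepro2.T5ConductorArithmetic

/-!
# T5ConductorDictionary — «conductor exactly `𝔭^{m+1}`» (p4's `conductor` along the unit filtration
`U_n = 1 + 𝔭^n`) ⟺ `IsPrimitiveChar` on `𝒪 ⧸ (ϖ^{m+1})`, and the Gauss-sum identity in that language

Kernel support for Tier 5, sub-step N5 / §G [R-4] (route/T5-CHECK-G-p7.md §4, §12.2 row P1.7, §16.2 row P1.10).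
`T5LocalRingGaussSum` proves `𝔤(χ)·𝔤(χ⁻¹) = χ(−1)` for a primitive character `χ` (`IsPrimitiveChar`) of a finite
local ring, and `T5DVRQuotientModel` reads that hypothesis on `𝒪 ⧸ (ϖ^{m+1})` as «`χ(π t) ≠ 1` for some unit
`t ≡ 1 (mod ϖ^m)`». The cell's conductor language is p4's: the filtration `higherUnits ϖ n = {u ∈ 𝒪^× ∣ ϖ^n ∣ u − 1}`
(`T5PrincipalUnitFiltration`, `U_n = 1 + 𝔭^n`) and `conductor U χ' = sInf {n ∣ U n ≤ ker χ'}` (`T5ConductorArithmetic`).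
This file is the dictionary between the two:

* `pull χ : 𝒪ˣ →* R'ˣ` — the character of `𝒪^×` obtained from `χ` through `𝒪^× → (𝒪/𝔭^{m+1})^×`;
* `higherUnits_succ_le_ker`: `U_{m+1} ≤ ker (pull χ)` (a character of `𝒪/𝔭^{m+1}` is trivial on `1 + 𝔭^{m+1}`),
  hence `conductor_pull_le : conductor (higherUnits ϖ) (pull χ) ≤ m + 1`;
* `isPrimitiveChar_iff_exists_mem_higherUnits`: `IsPrimitiveChar χ ↔ ∃ u ∈ U_m, pull χ u ≠ 1`;
* **`conductor_pull_eq_iff`**: `conductor (higherUnits ϖ) (pull χ) = m + 1 ↔ IsPrimitiveChar χ` —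
  «the conductor exponent of `χ` is exactly `m + 1`» is exactly the primitivity hypothesis of the Gauss-sum identity;
* `gNorm_mul_gNorm_inv_of_conductor`: the identity `𝔤(χ)·𝔤(χ⁻¹) = χ(−1)` on `𝒪 ⧸ (ϖ^{m+1})` against
  `ψ_{m+1} = shiftChar` (`x ↦ Ψ(x ϖ^{-(m+1)})`) for `χ` of conductor exactly `m + 1` and `Ψ` of conductor exactly `𝒪`;
* `epsShape_mul_epsShape_inv_of_conductor`: the ε-factor identity (T1) of CHECK-G §4
  (`T5EpsilonTwist.epsShape_mul_epsShape_inv`) with its Gauss-sum hypothesis discharged from these data.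
-/

namespace Summit.Ventures.HodgeRepro2.T5ConductorDictionary

open Summit.Ventures.HodgeRepro2.T5LocalRingGaussSum
open Summit.Ventures.HodgeRepro2.T5DVRQuotientModel
open Summit.Ventures.HodgeRepro2.T5PrincipalUnitFiltration
open Summit.Ventures.HodgeRepro2.T5ConductorArithmetic

variable {𝒪 : Type*} [CommRing 𝒪] [IsDomain 𝒪] [IsDiscreteValuationRing 𝒪] {ϖ : 𝒪} {m : ℕ}
  {R' : Type*} [CommMonoidWithZero R']

/-- The quotient map `𝒪 → 𝒪 ⧸ (ϖ^{m+1})`. -/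
local notation "π" => Ideal.Quotient.mk (Ideal.span ({ϖ ^ (m + 1)} : Set 𝒪))

omit [IsDomain 𝒪] [IsDiscreteValuationRing 𝒪] in
/-- The character `u ↦ χ(π u)` of `𝒪^×` attached to a multiplicative character `χ` of `𝒪 ⧸ (ϖ^{m+1})`
(values in the units of `R'`). -/
noncomputable def pull (χ : MulChar (𝒪 ⧸ Ideal.span ({ϖ ^ (m + 1)} : Set 𝒪)) R') : 𝒪ˣ →* R'ˣ :=
  χ.toUnitHom.comp (Units.map (Ideal.Quotient.mk (Ideal.span ({ϖ ^ (m + 1)} : Set 𝒪)) : 𝒪 →* _))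

omit [IsDomain 𝒪] [IsDiscreteValuationRing 𝒪] in
/-- `(pull χ u : R') = χ (π u)`. -/
@[simp] theorem pull_apply (χ : MulChar (𝒪 ⧸ Ideal.span ({ϖ ^ (m + 1)} : Set 𝒪)) R') (u : 𝒪ˣ) :
    ((pull χ u : R'ˣ) : R') = χ (π (u : 𝒪)) := by
  simp [pull]

omit [IsDomain 𝒪] [IsDiscreteValuationRing 𝒪] in
/-- `pull χ u ≠ 1 ↔ χ (π u) ≠ 1`. -/
theorem pull_ne_one_iff (χ : MulChar (𝒪 ⧸ Ideal.span ({ϖ ^ (m + 1)} : Set 𝒪)) R') (u : 𝒪ˣ) :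
    pull χ u ≠ 1 ↔ χ (π (u : 𝒪)) ≠ 1 := by
  rw [← pull_apply, Ne, Ne, Units.val_eq_one]

omit [IsDomain 𝒪] [IsDiscreteValuationRing 𝒪] in
/-- A character of `𝒪 ⧸ (ϖ^{m+1})` is trivial on `U_{m+1} = 1 + 𝔭^{m+1}`. -/
theorem higherUnits_succ_le_ker (χ : MulChar (𝒪 ⧸ Ideal.span ({ϖ ^ (m + 1)} : Set 𝒪)) R') :
    higherUnits ϖ (m + 1) ≤ (pull χ).ker := by
  intro u hu
  rw [mem_higherUnits] at hu
  rw [MonoidHom.mem_ker, ← Units.val_eq_one, pull_apply]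
  have h : π (u : 𝒪) = π 1 := by
    rw [Ideal.Quotient.eq, Ideal.mem_span_singleton]
    exact hu
  rw [h, map_one, MulChar.map_one]

omit [IsDomain 𝒪] [IsDiscreteValuationRing 𝒪] in
/-- The conductor exponent of `pull χ` along `U_n = 1 + 𝔭^n` is at most `m + 1`. -/
theorem conductor_pull_le (χ : MulChar (𝒪 ⧸ Ideal.span ({ϖ ^ (m + 1)} : Set 𝒪)) R') :
    conductor (higherUnits ϖ) (pull χ) ≤ m + 1 :=
  conductor_le_of_le_ker (higherUnits_succ_le_ker χ)

/-- `χ` is primitive on `𝒪 ⧸ (ϖ^{m+1})` iff `pull χ` is non-trivial on `U_m = 1 + 𝔭^m`. -/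
theorem isPrimitiveChar_iff_exists_mem_higherUnits (hϖ : Irreducible ϖ)
    (χ : MulChar (𝒪 ⧸ Ideal.span ({ϖ ^ (m + 1)} : Set 𝒪)) R') :
    IsPrimitiveChar χ ↔ ∃ u ∈ higherUnits ϖ m, pull χ u ≠ 1 := by
  rw [isPrimitiveChar_iff hϖ]
  constructor
  · rintro ⟨t, ht, ht1, hχ⟩
    obtain ⟨u, rfl⟩ := (isUnit_iff_not_dvd hϖ t).2 ht
    exact ⟨u, (mem_higherUnits ϖ m).2 ht1, (pull_ne_one_iff χ u).2 hχ⟩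
  · rintro ⟨u, hu, hχ⟩
    exact ⟨u, hϖ.not_dvd_unit u, (mem_higherUnits ϖ m).1 hu, (pull_ne_one_iff χ u).1 hχ⟩

/-- `χ` is primitive iff `U_m ≰ ker (pull χ)`. -/
theorem isPrimitiveChar_iff_not_le_ker (hϖ : Irreducible ϖ)
    (χ : MulChar (𝒪 ⧸ Ideal.span ({ϖ ^ (m + 1)} : Set 𝒪)) R') :
    IsPrimitiveChar χ ↔ ¬ higherUnits ϖ m ≤ (pull χ).ker := by
  rw [isPrimitiveChar_iff_exists_mem_higherUnits hϖ, SetLike.not_le_iff_exists]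
  simp only [MonoidHom.mem_ker]

/-- **Conductor dictionary.** The conductor exponent of `pull χ` along `U_n = 1 + 𝔭^n` (p4's
`conductor`) is exactly `m + 1` iff `χ` is primitive on `𝒪 ⧸ (ϖ^{m+1})` (`IsPrimitiveChar`): «`χ` has
conductor exactly `𝔭^{m+1}`» is the hypothesis of the Gauss-sum identity. -/
theorem conductor_pull_eq_iff (hϖ : Irreducible ϖ)
    (χ : MulChar (𝒪 ⧸ Ideal.span ({ϖ ^ (m + 1)} : Set 𝒪)) R') :
    conductor (higherUnits ϖ) (pull χ) = m + 1 ↔ IsPrimitiveChar χ := by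
  have hex : ∃ n, higherUnits ϖ n ≤ (pull χ).ker := ⟨m + 1, higherUnits_succ_le_ker χ⟩
  rw [isPrimitiveChar_iff_not_le_ker hϖ, ← conductor_le_iff (higherUnits_antitone ϖ) hex, not_le]
  constructor
  · intro h
    omega
  · intro h
    exact le_antisymm (conductor_pull_le χ) h

/-- The Gauss-sum identity `𝔤(χ)·𝔤(χ⁻¹) = χ(−1)` on `𝒪 ⧸ (ϖ^{m+1})` against `ψ_{m+1} = shiftChar`
(`x ↦ Ψ(x ϖ^{-(m+1)})`), for `χ` of conductor exactly `m + 1` (p4's `conductor`) and `Ψ` an additive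
character of the fraction field trivial on `𝒪` and non-trivial on `ϖ^{-1}𝒪`. -/
theorem gNorm_mul_gNorm_inv_of_conductor {K : Type*} [Field K] [Algebra 𝒪 K] [IsFractionRing 𝒪 K]
    [Fintype (𝒪 ⧸ Ideal.span ({ϖ ^ (m + 1)} : Set 𝒪))] (hϖ : Irreducible ϖ)
    {χ : MulChar (𝒪 ⧸ Ideal.span ({ϖ ^ (m + 1)} : Set 𝒪)) ℂ}
    (hχ : conductor (higherUnits ϖ) (pull χ) = m + 1) (Ψ : AddChar K ℂ)
    (hΨ : ∀ x : 𝒪, Ψ (algebraMap 𝒪 K x) = 1) {y : 𝒪}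
    (hy : Ψ (algebraMap 𝒪 K y / algebraMap 𝒪 K ϖ) ≠ 1) :
    gNorm χ (shiftChar m hϖ Ψ hΨ) * gNorm χ⁻¹ (shiftChar m hϖ Ψ hΨ) = χ (-1) := by
  haveI := isLocalRing_quot (m := m) hϖ
  exact gNorm_mul_gNorm_inv ((conductor_pull_eq_iff hϖ χ).1 hχ)
    ((isPrimitive_shiftChar_iff hϖ Ψ hΨ).2 ⟨y, hy⟩)

/-- **(T1) in the cell's printed vocabulary.** `T5EpsilonTwist.epsShape_mul_epsShape_inv` —
`ε(s, ω, ψ)·ε(1−s, ω⁻¹, ψ) = ω(−1)` for Kudla's printed shape of `ε` — with its Gauss-sum hypothesis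
DISCHARGED from: `χ` (the character of `𝒪/𝔭^{m+1}` through which `ω|_{𝒪^×}` factors) of conductor exactly
`m + 1` (p4's `conductor` along `U_n = 1 + 𝔭^n`), `Ψ` of conductor exactly `𝒪`, `G(ω|_U) = 𝔤(χ)`,
`G(ω⁻¹|_U) = 𝔤(χ⁻¹)` against `ψ_{m+1} = shiftChar`, and `ω(m1) = χ(−1)`. -/
theorem epsShape_mul_epsShape_inv_of_conductor {K : Type*} [Field K] [Algebra 𝒪 K]
    [IsFractionRing 𝒪 K] [Fintype (𝒪 ⧸ Ideal.span ({ϖ ^ (m + 1)} : Set 𝒪))] (hϖ : Irreducible ϖ)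
    {Kx : Type*} [CommGroup Kx] (U : Subgroup Kx) (ϖ' : Kx) {q : ℂ} (hq : q ≠ 0) (n : ℤ)
    (c : (Kx →* ℂˣ) → ℕ) (G : (U →* ℂˣ) → ℂ) (s : ℂ) (ω : Kx →* ℂˣ) (m1 : Kx) (hc : c ω⁻¹ = c ω)
    {χ : MulChar (𝒪 ⧸ Ideal.span ({ϖ ^ (m + 1)} : Set 𝒪)) ℂ}
    (hχ : conductor (higherUnits ϖ) (pull χ) = m + 1) (Ψ : AddChar K ℂ)
    (hΨ : ∀ x : 𝒪, Ψ (algebraMap 𝒪 K x) = 1) {y : 𝒪}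
    (hy : Ψ (algebraMap 𝒪 K y / algebraMap 𝒪 K ϖ) ≠ 1)
    (hG : G (ω.restrict U) = gNorm χ (shiftChar m hϖ Ψ hΨ))
    (hG' : G (ω⁻¹.restrict U) = gNorm χ⁻¹ (shiftChar m hϖ Ψ hΨ))
    (hm : ((ω m1 : ℂˣ) : ℂ) = χ (-1)) :
    T5EpsilonTwist.epsShape U ϖ' q n c G s ω * T5EpsilonTwist.epsShape U ϖ' q n c G (1 - s) ω⁻¹
      = ((ω m1 : ℂˣ) : ℂ) :=
  T5EpsilonTwist.epsShape_mul_epsShape_inv U ϖ' hq n c G s ω m1 hc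
    (by rw [hG, hG', gNorm_mul_gNorm_inv_of_conductor hϖ hχ Ψ hΨ hy, hm])

end Summit.Ventures.HodgeRepro2.T5ConductorDictionary
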